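import Mathlib
import Literature.Computability.AlgebraicComplexity.RankOneDeterminantalExpressionsProofs

/-!
# A verified subset dynamic programme for permanental minors (certificate infrastructure)

Helper file (`--supports stmt-ValiantsHypothesis-12624`) for crux `ValuativeGCT.ValuativeFlip`, line
`four-row-count` (`Cruxes/ValuativeFlip/Lines/four_row_count.lean`), wall-breaker axis k14
"tables / small cases certified".  The only open head stub of the line, `stub_fourRowPencilRank`, is
an `m`-free rank certificate for the family `X_t · (∂_{kl} per_n)(M·X)` of a four-variable pencil `M`
(`fourRowPencilRank_of_pencilCertificate`, `frt_finrank_fourRowSpan_ge`); its SMALL CASES (fixed `n`)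
are finite computations: the values of the family at integer points are `y_t · per(A(y)^{(k,l)})`,
permanental minors of integer matrices (`pb_aeval_pderiv_perPoly`), and a nonsingular minor of the
matrix of values modulo a prime certifies the rank (`prc_*` lemmas,
`Theorems/ValuativeGCTValuativeFlipPencilRankCertificates.lean`).  What was missing in the tree is a
way to EVALUATE permanental minors inside Lean with a kernel-checked meaning.  This file provides it:

* `PTbl R d` — a complete binary tree storing one value per subset of `Fin d` (a subset table);
  `PTbl.get`, `PTbl.add`, `PTbl.smul`, `PTbl.zero`, `PTbl.init` (the table `[S = ∅]`);
* `PTbl.step a T` — one row of the Laplace recursion, `S ↦ Σ_{i ∈ S} a i · T (S ∖ i)`, computed for all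
  subsets at once by structural recursion on the tree (this is the memoisation: cost `O(d · 2^d)`),
  with its semantics `PTbl.get_step`;
* `PTbl.dpF L rows` — the rows folded in, and the theorem `PTbl.get_dpF`: the entry at a subset `S`
  with `|S| = L` is the permanent of the `L × L` matrix (rows, columns of `S` in increasing order)
  — Laplace expansion along the first row (`permanent_laplace_row_zero`, from the column version
  `permanent_laplace_col_zero` of the Literature) and the uniqueness of increasing enumerations
  (`Finset.orderEmbOfFin_unique`);
* `PTbl.get_dpF_succAbove` — hence, for an `(n+1) × (n+1)` matrix `A`, the table of the rows `≠ k` read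
  at `univ ∖ {l}` is `per (A.submatrix k.succAbove l.succAbove)`, the permanental minor appearing in
  `pb_aeval_pderiv_perPoly`; and `permanent_map` (permanents commute with ring maps, so the
  computation may be done modulo a prime).

Everything is executable (used under `native_decide` by the certificate files) and every statement is
elementary. [folklore; Minc, *Permanents* (1978) §1.2 (Laplace expansion); Ryser 1963 Ch. 2 (subset
recursions for permanents)]
-/

set_option linter.dupNamespace false

namespace Summit.ValiantsHypothesis.ValiantsHypothesis.Theorems.ValuativeFlip

open scoped BigOperators Matrix

/-- **Laplace expansion of the permanent along row `0`** (transpose of the Literature's column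
version `permanent_laplace_col_zero`). [Minc 1978 §1.2; folklore] -/
theorem permanent_laplace_row_zero {R : Type*} [CommSemiring R] {n : ℕ}
    (A : Matrix (Fin n.succ) (Fin n.succ) R) :
    A.permanent = ∑ j : Fin n.succ, A 0 j * (A.submatrix Fin.succ j.succAbove).permanent := by
  rw [← Matrix.permanent_transpose,
    Literature.Computability.AlgebraicComplexity.permanent_laplace_col_zero]
  refine Finset.sum_congr rfl fun j _ => ?_
  rw [Matrix.transpose_apply, ← Matrix.permanent_transpose (A.submatrix Fin.succ j.succAbove),
    Matrix.transpose_submatrix]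

/-- Permanents commute with ring homomorphisms (so a permanent may be computed modulo a prime).
[folklore] -/
theorem permanent_map {R S : Type*} [CommSemiring R] [CommSemiring S] (f : R →+* S) {ι : Type*}
    [Fintype ι] [DecidableEq ι] (A : Matrix ι ι R) : (A.map f).permanent = f A.permanent := by
  simp only [Matrix.permanent, map_sum, map_prod, Matrix.map_apply]

/-- **Subset tables.** `PTbl R d` stores one value of `R` for every subset of `Fin d`: a leaf for
`d = 0` (the only subset is `∅`), and for `d + 1` a node whose left subtree holds the subsets NOT
containing `0` and whose right subtree holds those containing `0` (both as subsets of the remaining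
`d` coordinates). [folklore] -/
inductive PTbl (R : Type*) : ℕ → Type _
  /-- depth `0`: the value at `∅` -/
  | leaf : R → PTbl R 0
  /-- depth `d + 1`: (subsets without `0`, subsets with `0`) -/
  | node {d : ℕ} : PTbl R d → PTbl R d → PTbl R (d + 1)

namespace PTbl

variable {R : Type*}

/-- Lookup of the value stored at the subset with characteristic function `f`. [folklore] -/
def get : {d : ℕ} → PTbl R d → (Fin d → Bool) → R
  | 0, leaf v, _ => v
  | _ + 1, node t0 t1, f => if f 0 = true then get t1 (Fin.tail f) else get t0 (Fin.tail f)

/-- The all-zero table. [folklore] -/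
def zero [Zero R] : (d : ℕ) → PTbl R d
  | 0 => leaf 0
  | d + 1 => node (zero d) (zero d)

/-- The table of the function `S ↦ [S = ∅]` (start of the recursion: the empty permanent is `1`).
[folklore] -/
def init [Zero R] [One R] : (d : ℕ) → PTbl R d
  | 0 => leaf 1
  | d + 1 => node (init d) (zero d)

/-- Pointwise sum of two tables. [folklore] -/
def add [Add R] : {d : ℕ} → PTbl R d → PTbl R d → PTbl R d
  | 0, leaf v, leaf w => leaf (v + w)
  | _ + 1, node a b, node c e => node (add a c) (add b e)

/-- Pointwise scalar multiple of a table. [folklore] -/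
def smul [Mul R] (x : R) : {d : ℕ} → PTbl R d → PTbl R d
  | 0, leaf v => leaf (x * v)
  | _ + 1, node a b => node (smul x a) (smul x b)

/-- **One row of the Laplace recursion, for all subsets at once**: `step a T` is the table
`S ↦ Σ_{i ∈ S} a i · T (S ∖ {i})` (`get_step`).  Structural recursion on the tree: the subsets not
containing `0` only use the entries `a i`, `i ≥ 1`; those containing `0` get the extra term
`a 0 · T (S ∖ {0})`. [Ryser 1963 Ch. 2; folklore] -/
def step [Mul R] [Add R] [Zero R] : {d : ℕ} → (Fin d → R) → PTbl R d → PTbl R d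
  | 0, _, leaf _ => leaf 0
  | _ + 1, a, node t0 t1 => node (step (Fin.tail a) t0) (add (smul (a 0) t0) (step (Fin.tail a) t1))

/-- **The permanent DP**: fold the `L` rows `rows 0, …, rows (L-1)` into the start table; by `get_dpF`
the entry at an `L`-subset `S` is the permanent of the rows against the columns of `S`. [Ryser 1963
Ch. 2; folklore] -/
def dpF [Mul R] [Add R] [Zero R] [One R] {d : ℕ} : (L : ℕ) → (Fin L → Fin d → R) → PTbl R d
  | 0, _ => init d
  | L + 1, rows => step (rows 0) (dpF L (Fin.tail rows))

/-- The characteristic function of a finset, as the lookup key of a table. [folklore] -/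
def ind {d : ℕ} (S : Finset (Fin d)) : Fin d → Bool := fun i => decide (i ∈ S)

section Semantics

/-- Lookup in a leaf. [folklore] -/
@[simp] theorem get_leaf (v : R) (f : Fin 0 → Bool) : get (leaf v) f = v := rfl

/-- Lookup in a node: branch on the membership of `0`. [folklore] -/
@[simp] theorem get_node {d : ℕ} (t0 t1 : PTbl R d) (f : Fin (d + 1) → Bool) :
    get (node t0 t1) f = if f 0 = true then get t1 (Fin.tail f) else get t0 (Fin.tail f) := rfl

/-- The zero table is zero everywhere. [folklore] -/
theorem get_zero [Zero R] : ∀ (d : ℕ) (f : Fin d → Bool), get (zero d : PTbl R d) f = 0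
  | 0, _ => rfl
  | d + 1, f => by
      simp only [zero, get_node, get_zero d]
      split <;> rfl

/-- The start table is `[S = ∅]`. [folklore] -/
theorem get_init [Zero R] [One R] : ∀ (d : ℕ) (f : Fin d → Bool),
    get (init d : PTbl R d) f = if (∀ i, f i = false) then 1 else 0
  | 0, f => by
      simp only [init, get_leaf]
      rw [if_pos (fun i => i.elim0)]
  | d + 1, f => by
      simp only [init, get_node, get_zero, get_init d]
      by_cases h0 : f 0 = true
      · rw [if_pos h0, if_neg]
        intro hall
        rw [hall 0] at h0
        exact Bool.false_ne_true h0
      · rw [if_neg h0]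
        have h0' : f 0 = false := by simpa using h0
        by_cases hall : ∀ i, f i = false
        · rw [if_pos hall, if_pos (show ∀ i : Fin d, Fin.tail f i = false from fun i => hall i.succ)]
        · rw [if_neg hall, if_neg]
          intro htail
          refine hall (fun i => Fin.cases h0' (fun j => ?_) i)
          exact htail j

/-- Lookup is additive. [folklore] -/
theorem get_add [Add R] : ∀ {d : ℕ} (s t : PTbl R d) (f : Fin d → Bool),
    get (add s t) f = get s f + get t f
  | 0, leaf v, leaf w, _ => rfl
  | _ + 1, node a b, node c e, f => by
      simp only [add, get_node, get_add a, get_add b]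
      split <;> rfl

/-- Lookup commutes with scalars. [folklore] -/
theorem get_smul [Mul R] (x : R) : ∀ {d : ℕ} (t : PTbl R d) (f : Fin d → Bool),
    get (smul x t) f = x * get t f
  | 0, leaf v, _ => rfl
  | _ + 1, node a b, f => by
      simp only [smul, get_node, get_smul x a, get_smul x b]
      split <;> rfl

/-- **Semantics of one Laplace row**: `(step a T)(S) = Σ_{i ∈ S} a i · T(S ∖ {i})`, written with
characteristic functions (`S ∖ {i}` is `Function.update f i false`). [Ryser 1963 Ch. 2; folklore] -/
theorem get_step [CommSemiring R] : ∀ {d : ℕ} (a : Fin d → R) (t : PTbl R d) (f : Fin d → Bool),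
    get (step a t) f = ∑ i : Fin d, if f i = true then a i * get t (Function.update f i false) else 0
  | 0, a, leaf v, f => by simp [step, get]
  | d + 1, a, node t0 t1, f => by
      have h00 : Function.update f 0 false 0 = false := Function.update_self 0 false f
      have h0S : ∀ i : Fin d, Function.update f i.succ false 0 = f 0 := fun i =>
        Function.update_of_ne (Fin.succ_ne_zero i).symm false f
      have htail0 : Fin.tail (Function.update f 0 false) = Fin.tail f :=
        Fin.tail_update_zero _ _
      have htailS : ∀ i : Fin d, Fin.tail (Function.update f i.succ false) =
          Function.update (Fin.tail f) i false := fun i => Fin.tail_update_succ _ _ _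
      have hA : get (node t0 t1) (Function.update f 0 false) = get t0 (Fin.tail f) := by
        rw [get_node, if_neg (by rw [h00]; exact Bool.false_ne_true), htail0]
      have hB : ∀ i : Fin d, get (node t0 t1) (Function.update f i.succ false) =
          if f 0 = true then get t1 (Function.update (Fin.tail f) i false)
          else get t0 (Function.update (Fin.tail f) i false) := fun i => by
        rw [get_node, h0S, htailS]
      rw [Fin.sum_univ_succ]
      simp only [hA, hB]
      simp only [step, get_node, get_add, get_smul, get_step (Fin.tail a)]
      by_cases h0 : f 0 = true
      · simp only [h0, ite_true]
        rfl
      · simp only [h0, Bool.false_eq_true, ite_false, zero_add]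
        rfl

/-- Removing `i` from a finset is `Function.update (ind S) i false` on characteristic functions.
[folklore] -/
theorem update_ind {d : ℕ} (S : Finset (Fin d)) (i : Fin d) :
    Function.update (ind S) i false = ind (S.erase i) := by
  funext j
  by_cases h : j = i
  · subst h
    simp [ind]
  · rw [Function.update_of_ne h]
    simp [ind, Finset.mem_erase, h]

/-- **The DP computes permanents.**  After folding `L` rows, the entry of the table at an `L`-subset
`S` (characteristic function `ind S`) is the permanent of the `L × L` matrix whose `x`-th row is
`rows x` restricted to the columns of `S` in increasing order (`S.orderEmbOfFin`).  Induction on `L`: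
`get_step` is the Laplace expansion along the first row (`permanent_laplace_row_zero`), the columns
of `S ∖ {e j}` in increasing order being `e ∘ j.succAbove` (`Finset.orderEmbOfFin_unique`).
[Minc 1978 §1.2; Ryser 1963 Ch. 2; folklore] -/
theorem get_dpF [CommSemiring R] {d : ℕ} : ∀ (L : ℕ) (rows : Fin L → Fin d → R)
    (S : Finset (Fin d)) (h : S.card = L),
    get (dpF L rows) (ind S) =
      (Matrix.of fun x y : Fin L => rows x (S.orderEmbOfFin h y)).permanent
  | 0, rows, S, h => by
      have hS : S = ∅ := Finset.card_eq_zero.mp h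
      subst hS
      rw [Matrix.permanent_isEmpty, dpF, get_init, if_pos]
      intro i
      simp [ind]
  | L + 1, rows, S, h => by
      rw [dpF, get_step, permanent_laplace_row_zero]
      set e := S.orderEmbOfFin h with he_def
      -- the columns of `S ∖ {e j}` in increasing order
      have hmem : ∀ j : Fin (L + 1), e j ∈ S := fun j => Finset.orderEmbOfFin_mem S h j
      have hcard : ∀ j : Fin (L + 1), (S.erase (e j)).card = L := fun j => by
        rw [Finset.card_erase_of_mem (hmem j), h, Nat.add_sub_cancel]
      have hcols : ∀ j : Fin (L + 1),
          (fun y : Fin L => e (j.succAbove y)) = (S.erase (e j)).orderEmbOfFin (hcard j) := fun j => by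
        refine Finset.orderEmbOfFin_unique (hcard j) (fun y => ?_) ?_
        · exact Finset.mem_erase.mpr ⟨fun heq => Fin.succAbove_ne j y (e.injective heq), hmem _⟩
        · exact e.strictMono.comp (Fin.strictMono_succAbove j)
      -- rewrite each cofactor through the induction hypothesis (backwards)
      have hcof : ∀ j : Fin (L + 1),
          ((Matrix.of fun x y : Fin (L + 1) => rows x (e y)).submatrix Fin.succ j.succAbove).permanent =
            get (dpF L (Fin.tail rows)) (ind (S.erase (e j))) := fun j => by
        rw [get_dpF L (Fin.tail rows) (S.erase (e j)) (hcard j)]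
        congr 1
        ext x y
        simp only [Matrix.submatrix_apply, Matrix.of_apply, Fin.tail]
        exact congrArg (rows x.succ) (congrFun (hcols j) y)
      simp only [hcof, Matrix.of_apply]
      -- both sides are now sums of the same total function
      set G : Fin d → R := fun i => rows 0 i * get (dpF L (Fin.tail rows)) (ind (S.erase i)) with hG
      have hL : (∑ i : Fin d, if ind S i = true then
          rows 0 i * get (dpF L (Fin.tail rows)) (Function.update (ind S) i false) else 0) =
          ∑ i ∈ S, G i := by
        simp only [update_ind, ind, decide_eq_true_eq]
        rw [Finset.sum_ite_mem, Finset.univ_inter]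
      have himage : (Finset.univ.image e) = S := by
        apply Finset.coe_injective
        rw [Finset.coe_image, Finset.coe_univ, Set.image_univ]
        exact Finset.range_orderEmbOfFin S h
      have hR : ∑ j : Fin (L + 1), G (e j) = ∑ i ∈ S, G i := by
        rw [← himage, Finset.sum_image (fun x _ y _ hxy => e.injective hxy)]
      rw [hL, ← hR]

/-- **Permanental minors by the DP.**  For an `(n+1) × (n+1)` matrix `A` and `k, l`, folding the `n`
rows `A (k.succAbove x)` and reading the table at `univ ∖ {l}` gives
`per (A.submatrix k.succAbove l.succAbove)` — the minor of `pb_aeval_pderiv_perPoly`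
(`(∂_{kl} per)(A) = per A^{(k,l)}`). [von zur Gathen 1987 §2; folklore] -/
theorem get_dpF_succAbove [CommSemiring R] {n : ℕ} (A : Matrix (Fin (n + 1)) (Fin (n + 1)) R)
    (k l : Fin (n + 1)) :
    get (dpF n (fun x : Fin n => A (k.succAbove x))) (ind (Finset.univ.erase l)) =
      (A.submatrix k.succAbove l.succAbove).permanent := by
  have hcard : (Finset.univ.erase l).card = n := by
    rw [Finset.card_erase_of_mem (Finset.mem_univ l), Finset.card_univ, Fintype.card_fin,
      Nat.add_sub_cancel]
  rw [get_dpF n _ _ hcard]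
  have he : (l.succAbove : Fin n → Fin (n + 1)) = (Finset.univ.erase l).orderEmbOfFin hcard :=
    Finset.orderEmbOfFin_unique hcard
      (fun x => Finset.mem_erase.mpr ⟨Fin.succAbove_ne l x, Finset.mem_univ _⟩)
      (Fin.strictMono_succAbove l)
  congr 1
  ext x y
  simp only [Matrix.of_apply, Matrix.submatrix_apply]
  exact congrArg (A (k.succAbove x)) (congrFun he y).symm

end Semantics

end PTbl

end Summit.ValiantsHypothesis.ValiantsHypothesis.Theorems.ValuativeFlip
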